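import Literature.Analysis.FluidPDE.StokesTorusSemigroupDiagonal
import Literature.Analysis.FluidPDE.EnergySpaceTorusHilbertBasisProofs
import HarnessLib

/-!
# The Stokes semigroup frame `(1 + A)^{-1/2}`, `(1 + A)⁻¹`, `e^{-tA}`, `A^{3/4} e^{-tA}` on the
# energy space of the flat torus

Topic `Literature/Analysis/FluidPDE`; companion of `StokesTorusSemigroupDiagonal.lean` (the
semigroup frame of an abstract non-negative diagonal operator `b.diagonalPMap m`,
`exists_semigroupFrame_diagonalPMap`), of `StokesTorusResolvent.lean` /
`StokesTorusSqrtResolvent.lean` (`(1 + A)⁻¹`, `(1 + A)^{-1/2}` alone) and of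
`EnergySpaceTorusHilbertBasisProofs.lean`
(`exists_hilbertBasis_stokes_holds`: the Stokes operator `A = Torus.stokesOperatorH d` on the
mean-zero solenoidal energy space `H = Torus.energySpace d ⊂ L²(T^d; ℝ^d)` is the maximal diagonal
operator `b.diagonalPMap m` in a Hilbert basis `b` of Stokes modes, `0 < m i = 4π²|kᵢ|² → ∞`).

**Theorems** (no definitions, no named facts):

* `exists_semigroupFrame_of_eq_diagonalPMap` — the conjunction of
  `exists_semigroupFrame_diagonalPMap` for any operator `A` *equal* to `b.diagonalPMap m` (the
  form in which a concrete operator is presented by its eigenbasis; it spares users on concrete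
  function spaces the expensive rewriting along `A = b.diagonalPMap m` inside the conjunction);
* `Torus.exists_stokesSemigroupFrame` — the **Stokes semigroup frame** on `H = Torus.energySpace d`:
  a Hilbert basis `b` of `H` of eigenvectors of `A` with eigenvalues `0 < m i → ∞`,
  `A = b.diagonalPMap m`, and the bounded operators `S = (1 + A)^{-1/2}`, `R = (1 + A)⁻¹ = S ∘ S`,
  the Stokes semigroup `T t = e^{-tA}` (`t ≥ 0`) and its smoothed form `K t = A^{3/4} e^{-tA}`
  (`t > 0`), all diagonal in `b` (`S (b i) = (1 + m i)^{-1/2} b i`, `R (b i) = (1 + m i)⁻¹ b i`,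
  `T t (b i) = e^{-t m i} b i`, `K t (b i) = m i^{3/4} e^{-t m i} b i`), with: `S` an injective
  self-adjoint compact contraction, `(1 + A) R = 1` on `H`, `R (1 + A) = 1` on `D(A)`, the frame
  identity `‖z‖² = ‖S z‖² + ⟪A (S z), S z⟫` (`S z ∈ D(A)`); `T` a strongly continuous contraction
  semigroup of self-adjoint operators commuting with `S`, compact for `t > 0`; the smoothing
  estimate `‖K t‖ ≤ t^{-3/4}`, `K (s + t) = T s ∘ K t`, `K t ∘ S = S ∘ K t`, and strong continuity
  of `K` on `(0, ∞)` (Constantin–Foias 1988, Ch. 4, (4.4)–(4.7), (4.11)–(4.13): `A` is positive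
  self-adjoint with compact inverse, `A w_j = λ_j w_j`, `0 < λ_1 ≤ λ_2 ≤ ⋯ → ∞`, functions of `A`
  act diagonally; Henry 1981, Thm. 1.3.4, Thm. 1.4.3: `e^{-tA}` analytic,
  `‖A^α e^{-tA}‖ ≤ C_α t^{-α}`; Pazy 1983, Thm. 2.6.13).

This is the operator frame of the mild formulation
`u(t) = e^{-νtA} u₀ - ∫₀ᵗ A^{3/4} e^{-ν(t-s)A} A^{-3/4} P (u·∇u)(s) ds` of the Navier–Stokes
equations on `T³` (Fujita–Kato).  For `t < 0` the witnesses take junk values (`T t = 1`,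
`K t = 0`, also `K 0 = 0`) about which nothing is asserted.  Deliberately NOT here: fractional
powers `A^α` in general, analyticity of the semigroup, any nonlinear estimate.

## References

* P. Constantin, C. Foias, *Navier–Stokes Equations* (Univ. Chicago Press, 1988), Ch. 4,
  (4.4)–(4.7), (4.11)–(4.13). [ConstantinFoiasNSE1988]
* D. Henry, *Geometric Theory of Semilinear Parabolic Equations*, LNM 840 (Springer, 1981),
  Thm. 1.3.4, Thm. 1.4.3. [Henry1981]
* A. Pazy, *Semigroups of Linear Operators and Applications to PDE* (Springer, 1983), Thm. 2.6.13.
  [Pazy1983]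
* M. Reed, B. Simon, *Methods of Modern Mathematical Physics I* (Academic Press, 1980), §VIII.3.
  [ReedSimonI1980]
-/

noncomputable section

open Filter
open scoped InnerProductSpace ENNReal Topology

namespace Literature.Analysis.FluidPDE

/-! ### The semigroup frame of an operator equal to a diagonal operator -/

/-- **Semigroup frame of an operator equal to a non-negative diagonal operator.**  The conjunction
of `exists_semigroupFrame_diagonalPMap` for any (unbounded) operator `A : H →ₗ.[ℝ] H` with
`A = b.diagonalPMap m` (`b` a Hilbert basis of the real Hilbert space `H`, `0 ≤ m i → ∞` along the
cofinite filter) — the form in which a concrete self-adjoint operator with compact resolvent is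
presented by its eigenbasis (e.g. the Stokes operator, `Torus.exists_hilbertBasis_stokes_holds`):
bounded operators `S = (1 + A)^{-1/2}`, `R = (1 + A)⁻¹`, `T t = e^{-tA}`, `K t = A^{3/4} e^{-tA}`,
diagonal in `b`, with the resolvent identities, the frame identity, the contraction-semigroup,
self-adjointness, compactness and commutation laws of `T`, the smoothing bound `‖K t‖ ≤ t^{-3/4}`,
`K (s + t) = T s ∘ K t` and the strong continuity of `T` on `ℝ` and of `K` on `(0, ∞)`
(Henry 1981, Thm. 1.3.4, Thm. 1.4.3; Reed–Simon I, §VIII.3 Proposition 1, Thm. VIII.4–VIII.6).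
Proof: `subst` and `exists_semigroupFrame_diagonalPMap`. [folklore] -/
theorem exists_semigroupFrame_of_eq_diagonalPMap {ι H : Type*} [NormedAddCommGroup H]
    [InnerProductSpace ℝ H] [CompleteSpace H] (b : HilbertBasis ι ℝ H) {m : ι → ℝ}
    (hpos : ∀ i, 0 ≤ m i) (htend : Tendsto m cofinite atTop) {A : H →ₗ.[ℝ] H}
    (hA : A = b.diagonalPMap m) :
    ∃ (S R : H →L[ℝ] H) (T K : ℝ → H →L[ℝ] H),
      (∀ i, S (b i) = ((1 + m i) ^ (-(1 / 2 : ℝ))) • b i) ∧ (∀ i, R (b i) = (1 + m i)⁻¹ • b i) ∧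
      (∀ t i, 0 ≤ t → T t (b i) = Real.exp (-(t * m i)) • b i) ∧
      (∀ t i, 0 < t → K t (b i) = ((m i) ^ (3 / 4 : ℝ) * Real.exp (-(t * m i))) • b i) ∧
      S.comp S = R ∧ Function.Injective S ∧ ‖S‖ ≤ 1 ∧ IsSelfAdjoint S ∧ IsCompactOperator S ∧
      (∀ v : H, ∃ hv : R v ∈ A.domain, R v + A ⟨R v, hv⟩ = v) ∧
      (∀ (v : H) (hv : v ∈ A.domain), R (v + A ⟨v, hv⟩) = v) ∧
      (∀ (z : H) (hz : S z ∈ A.domain), ‖z‖ ^ 2 = ‖S z‖ ^ 2 + ⟪A ⟨S z, hz⟩, S z⟫_ℝ) ∧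
      (∀ t, 0 ≤ t → ‖T t‖ ≤ 1) ∧ T 0 = 1 ∧ (∀ s t, 0 ≤ s → 0 ≤ t → T (s + t) = (T s).comp (T t)) ∧
      (∀ y : H, Continuous fun t : ℝ => T t y) ∧ (∀ t, (T t).comp S = S.comp (T t)) ∧
      (∀ t, 0 ≤ t → IsSelfAdjoint (T t)) ∧ (∀ t, 0 < t → IsCompactOperator (T t)) ∧
      (∀ t, 0 < t → ‖K t‖ ≤ t ^ (-(3 / 4 : ℝ))) ∧
      (∀ s t, 0 ≤ s → 0 < t → K (s + t) = (T s).comp (K t)) ∧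
      (∀ t, (K t).comp S = S.comp (K t)) ∧
      (∀ y : H, ContinuousOn (fun t : ℝ => K t y) (Set.Ioi 0)) := by
  subst hA
  exact exists_semigroupFrame_diagonalPMap b hpos htend

/-! ### The Stokes semigroup frame on the torus -/

namespace Torus

/-- **The Stokes semigroup frame on the energy space of the flat torus.**  For the Stokes operator
`A = Torus.stokesOperatorH d` on `H = Torus.energySpace d` (mean-zero solenoidal `L²` vector fields
on `T^d`) there are: a Hilbert basis `b` of `H` (of Stokes modes) with eigenvalues `0 < m i → ∞`
along the cofinite filter and `A = b.diagonalPMap m`; bounded operators `S = (1 + A)^{-1/2}`,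
`R = (1 + A)⁻¹` and families `T t = e^{-tA}` (the Stokes semigroup), `K t = A^{3/4} e^{-tA}`, all
diagonal in `b` — `S (b i) = (1 + m i)^{-1/2} b i`, `R (b i) = (1 + m i)⁻¹ b i`,
`T t (b i) = e^{-t m i} b i` (`t ≥ 0`), `K t (b i) = m i^{3/4} e^{-t m i} b i` (`t > 0`) — such that
`S ∘ S = R`, `S` is injective, `‖S‖ ≤ 1`, self-adjoint and compact, `R v ∈ D(A)` with
`R v + A (R v) = v` (`v ∈ H`), `R (v + A v) = v` (`v ∈ D(A)`), `‖z‖² = ‖S z‖² + ⟪A (S z), S z⟫`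
(`S z ∈ D(A)`); `‖T t‖ ≤ 1`, `T 0 = 1`, `T (s + t) = T s ∘ T t`, `t ↦ T t y` continuous,
`T t ∘ S = S ∘ T t`, `T t` self-adjoint (`t ≥ 0`) and compact (`t > 0`); `‖K t‖ ≤ t^{-3/4}`,
`K (s + t) = T s ∘ K t` (`s ≥ 0`, `t > 0`), `K t ∘ S = S ∘ K t`, `t ↦ K t y` continuous on `(0, ∞)`
(Constantin–Foias 1988, Ch. 4, (4.4)–(4.7), (4.11)–(4.13): `A` positive self-adjoint with compact
inverse, `A w_j = λ_j w_j`, `0 < λ_1 ≤ λ_2 ≤ ⋯ → ∞`, `f(A) w_j = f(λ_j) w_j`; Henry 1981, Thm. 1.3.4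
and Thm. 1.4.3: `‖A^α e^{-tA}‖ ≤ C_α t^{-α}`; Temam 1977, Ch. I §2.6).  Proof: the tree's eigenbasis
`exists_hilbertBasis_stokes_holds` and `exists_semigroupFrame_of_eq_diagonalPMap`.  Junk values
(`T t = 1` for `t < 0`, `K t = 0` for `t ≤ 0`) are not spoken about.
[cite: ConstantinFoiasNSE1988, Ch. 4 (4.4)–(4.7), (4.11)–(4.13)] -/
theorem exists_stokesSemigroupFrame (d : Type*) [Fintype d] [DecidableEq d] :
    ∃ (ι : Type) (b : HilbertBasis ι ℝ (FunctionSpaces.Torus.energySpace d)) (m : ι → ℝ)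
      (S R : FunctionSpaces.Torus.energySpace d →L[ℝ] FunctionSpaces.Torus.energySpace d)
      (T K : ℝ → FunctionSpaces.Torus.energySpace d →L[ℝ] FunctionSpaces.Torus.energySpace d),
      (∀ i, 0 < m i) ∧ Tendsto m cofinite atTop ∧ stokesOperatorH d = b.diagonalPMap m ∧
      (∀ i, S (b i) = ((1 + m i) ^ (-(1 / 2 : ℝ))) • b i) ∧ (∀ i, R (b i) = (1 + m i)⁻¹ • b i) ∧
      (∀ t i, 0 ≤ t → T t (b i) = Real.exp (-(t * m i)) • b i) ∧
      (∀ t i, 0 < t → K t (b i) = ((m i) ^ (3 / 4 : ℝ) * Real.exp (-(t * m i))) • b i) ∧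
      S.comp S = R ∧ Function.Injective S ∧ ‖S‖ ≤ 1 ∧ IsSelfAdjoint S ∧ IsCompactOperator S ∧
      (∀ v : FunctionSpaces.Torus.energySpace d, ∃ hv : R v ∈ (stokesOperatorH d).domain,
        R v + stokesOperatorH d ⟨R v, hv⟩ = v) ∧
      (∀ (v : FunctionSpaces.Torus.energySpace d) (hv : v ∈ (stokesOperatorH d).domain),
        R (v + stokesOperatorH d ⟨v, hv⟩) = v) ∧
      (∀ (z : FunctionSpaces.Torus.energySpace d) (hz : S z ∈ (stokesOperatorH d).domain),
        ‖z‖ ^ 2 = ‖S z‖ ^ 2 + ⟪stokesOperatorH d ⟨S z, hz⟩, S z⟫_ℝ) ∧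
      (∀ t, 0 ≤ t → ‖T t‖ ≤ 1) ∧ T 0 = 1 ∧ (∀ s t, 0 ≤ s → 0 ≤ t → T (s + t) = (T s).comp (T t)) ∧
      (∀ y : FunctionSpaces.Torus.energySpace d, Continuous fun t : ℝ => T t y) ∧
      (∀ t, (T t).comp S = S.comp (T t)) ∧ (∀ t, 0 ≤ t → IsSelfAdjoint (T t)) ∧
      (∀ t, 0 < t → IsCompactOperator (T t)) ∧
      (∀ t, 0 < t → ‖K t‖ ≤ t ^ (-(3 / 4 : ℝ))) ∧
      (∀ s t, 0 ≤ s → 0 < t → K (s + t) = (T s).comp (K t)) ∧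
      (∀ t, (K t).comp S = S.comp (K t)) ∧
      (∀ y : FunctionSpaces.Torus.energySpace d,
        ContinuousOn (fun t : ℝ => K t y) (Set.Ioi 0)) := by
  obtain ⟨ι, b, m, -, hpos, htend, hA, -⟩ := exists_hilbertBasis_stokes_holds (d := d)
  obtain ⟨S, R, T, K, h⟩ :=
    exists_semigroupFrame_of_eq_diagonalPMap b (fun i => (hpos i).le) htend hA
  exact ⟨ι, b, m, S, R, T, K, hpos, htend, hA, h⟩

end Torus

end Literature.Analysis.FluidPDE
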